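import Mathlib
import HarnessLib
import Literature.MathematicalPhysics.QuantumLattice.FermiRG.BGM2003Sectors
import Summits.HubbardSuperconductivity.HubbardSuperconductivity.Theorems.KLProgrammeAbsUmklappNarrowCount
import Summits.HubbardSuperconductivity.HubbardSuperconductivity.Theorems.KLProgrammeAbsUmklappClassCountPrescribed

/-!
# Route `KLProgramme` — K3 engine (stmt-HubbardSuperconductivity-20437), stub (b) (ℓ)/(I2)–(I3), located item «ABS-UMK-COUNT»:
# the NARROW-BUNDLE COUNT WITH A PRESCRIBED SET OF LEGS — `≤ 2L⁴ · T_bound · N · K₀^{L − |E| − 4}`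

Cell gate-hubbard-kl, seat p4 g15 (prescribed-set generalisation of `card_narrowStrings_le`).  With a set `E` of legs carrying prescribed labels and at least five
free legs (`|E| + 5 ≤ L`), every string whose free legs are pairwise within pair angle `Φ₀` falls in a class of `card_narrowClass_prescribed_le`
(`exists_base_triple_of_free`: the pigeonhole of …NarrowCount on the free set); summing over ordered quadruples of free legs and the two shifts:

* `exists_base_triple_of_free` — coverage for an arbitrary free set `F`, `|F| ≥ 5`;
* **`card_narrowStrings_prescribed_le`** — `#{ω : ω|_E = τ|_E, free legs narrow, Σ k = R} ≤ 2L⁴ · T_bound · N · K₀^{L − |E| − 4}`.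

(With exactly four free legs split two–two across antipodes no equal-sign triple exists; that boundary case keeps the last-leg law and is not treated here.)
Everything is PROVED; no definitions, no named facts. [cite: BenfattoGiulianiMastropietro2003, §7.4 (s1.21)–(s1.25a) p.28 (L19–52)]
-/

noncomputable section

open Real Set
open Literature.MathematicalPhysics.QuantumLattice Literature.MathematicalPhysics.QuantumLattice.FermiRG
open Literature.MathematicalPhysics.QuantumLattice.FermiRG.BGM2003
open Summit.HubbardSuperconductivity.HubbardSuperconductivity.Theorems.ThinLevelSet
open Summit.HubbardSuperconductivity.HubbardSuperconductivity.Theorems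

namespace Summit.HubbardSuperconductivity.HubbardSuperconductivity.Theorems.AbsUmklappCount

set_option linter.dupNamespace false -- summit = problem name (single-conjunct summit), D-0017

/-! ## §1 Coverage on a free set -/

open Classical in
/-- **Coverage, free-set form**: if the legs of a set `F` with `|F| ≥ 5` are pairwise within pair angle `Φ₀`, then there are four distinct legs `s, a, b, c ∈ F`
and a shift `σ ∈ {0, π}` with `a, b, c` within torus distance `2Φ₀` of `θ_s + σ` (pigeonhole on the two sides of a reference leg). [folklore] -/
theorem exists_base_triple_of_free {L : ℕ} (F : Finset (Fin L)) (hF : 5 ≤ F.card) (θ : Fin L → ℝ) {Φ₀ : ℝ} (hΦ₀ : 0 ≤ Φ₀)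
    (hnar : ∀ i j : Fin L, i ∈ F → j ∈ F → pairAngle (θ i) (θ j) ≤ Φ₀) :
    ∃ s a b c : Fin L, s ∈ F ∧ a ∈ F ∧ b ∈ F ∧ c ∈ F ∧ s ≠ a ∧ s ≠ b ∧ s ≠ c ∧ a ≠ b ∧ a ≠ c ∧ b ≠ c ∧
      ∃ σ : ℝ, (σ = 0 ∨ σ = π) ∧ ∀ x ∈ ({a, b, c} : Finset (Fin L)), FermiRG.torusDist (θ x - (θ s + σ)) ≤ 2 * Φ₀ := by
  have hFne : F.Nonempty := by rw [← Finset.card_pos]; omega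
  obtain ⟨e, he⟩ := hFne
  set P := F.filter fun i => FermiRG.torusDist (θ i - θ e) ≤ Φ₀ with hP
  set Q := F.filter fun i => ¬ FermiRG.torusDist (θ i - θ e) ≤ Φ₀ with hQ
  have hPQ : P.card + Q.card = F.card := by
    rw [hP, hQ, Finset.card_filter_add_card_filter_not]
  have hPc : ∀ i ∈ P, FermiRG.torusDist (θ i - θ e) ≤ Φ₀ := fun i hi => (Finset.mem_filter.1 hi).2
  have hQc : ∀ i ∈ Q, FermiRG.torusDist (θ i - (θ e + π)) ≤ Φ₀ := by
    intro i hi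
    obtain ⟨hiF, hnot⟩ := Finset.mem_filter.1 hi
    rcases torusDist_alt_of_pairAngle_le (hnar i e hiF he) with h | h
    · exact absurd h hnot
    · exact h
  have hPF : ∀ i ∈ P, i ∈ F := fun i hi => (Finset.mem_filter.1 hi).1
  have hQF : ∀ i ∈ Q, i ∈ F := fun i hi => (Finset.mem_filter.1 hi).1
  have heP : e ∈ P := by
    rw [hP, Finset.mem_filter]; refine ⟨he, ?_⟩
    rw [sub_self]; unfold FermiRG.torusDist; simpa using hΦ₀
  have hPQdisj : ∀ i ∈ P, i ∉ Q := fun i hi hiQ => (Finset.mem_filter.1 hiQ).2 (hPc i hi)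
  have hQPdisj : ∀ i ∈ Q, i ∉ P := fun i hi hiP => (Finset.mem_filter.1 hi).2 (hPc i hiP)
  -- the conclusion from a base `s`, a set `T` of candidates and a centre
  have hfinish : ∀ (s : Fin L) (T : Finset (Fin L)) (c₀ σ : ℝ), s ∈ F → (∀ i ∈ T, i ∈ F) → 2 < T.card →
      (∀ i ∈ T, FermiRG.torusDist (θ i - c₀) ≤ Φ₀) → FermiRG.torusDist (θ s + σ - c₀) ≤ Φ₀ → s ∉ T → (σ = 0 ∨ σ = π) →
      ∃ s a b c : Fin L, s ∈ F ∧ a ∈ F ∧ b ∈ F ∧ c ∈ F ∧ s ≠ a ∧ s ≠ b ∧ s ≠ c ∧ a ≠ b ∧ a ≠ c ∧ b ≠ c ∧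
        ∃ σ : ℝ, (σ = 0 ∨ σ = π) ∧ ∀ x ∈ ({a, b, c} : Finset (Fin L)), FermiRG.torusDist (θ x - (θ s + σ)) ≤ 2 * Φ₀ := by
    intro s T c₀ σ hsi hTi hT hTc hs hsT hσ
    obtain ⟨a, b, c, ha, hb, hc, hsa, hsb, hsc, hab, hac, hbc, hx⟩ := triple_near_base θ hT hTc hs hsT
    exact ⟨s, a, b, c, hsi, hTi a ha, hTi b hb, hTi c hc, hsa, hsb, hsc, hab, hac, hbc, σ, hσ, hx⟩
  by_cases hP4 : 4 ≤ P.card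
  · -- (i) four legs on the side of `e`: base `e`, triple in `P \\ {e}`
    refine hfinish e (P.erase e) (θ e) 0 he (fun i hi => hPF i (Finset.mem_of_mem_erase hi)) ?_
      (fun i hi => hPc i (Finset.mem_of_mem_erase hi)) ?_ (Finset.notMem_erase e P) (Or.inl rfl)
    · rw [Finset.card_erase_of_mem heP]; omega
    · rw [add_zero, sub_self]; unfold FermiRG.torusDist; simpa using hΦ₀
  by_cases hQ4 : 4 ≤ Q.card
  · -- (ii) four legs on the far side: base some `s ∈ Q`, triple in `Q \\ {s}`
    have hQne : Q.Nonempty := by rw [← Finset.card_pos]; omega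
    obtain ⟨s, hsQ⟩ := hQne
    refine hfinish s (Q.erase s) (θ e + π) 0 (hQF s hsQ) (fun i hi => hQF i (Finset.mem_of_mem_erase hi)) ?_
      (fun i hi => hQc i (Finset.mem_of_mem_erase hi)) ?_ (Finset.notMem_erase s Q) (Or.inl rfl)
    · rw [Finset.card_erase_of_mem hsQ]; omega
    · rw [add_zero]; exact hQc s hsQ
  by_cases hP3 : P.card = 3
  · -- (iii) exactly three on the side of `e`: base some `s ∈ Q` seen through the shift `π`
    have hQne : Q.Nonempty := by rw [← Finset.card_pos]; omega
    obtain ⟨s, hsQ⟩ := hQne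
    refine hfinish s P (θ e) π (hQF s hsQ) hPF (by omega) hPc ?_ (hQPdisj s hsQ) (Or.inr rfl)
    have e1 : θ s + π - θ e = (θ s - (θ e + π)) + (1 : ℤ) * (2 * π) := by push_cast; ring
    rw [e1, PerturbedFermiCurve.torusDist_add_int_mul_two_pi]; exact hQc s hsQ
  · -- (iv) `#P ≤ 2`, hence `#Q = 3`: base `e`, triple `Q`, shift `π`
    have hQ3 : Q.card = 3 := by omega
    refine hfinish e Q (θ e + π) π he hQF (by omega) hQc ?_ (hPQdisj e heP) (Or.inr rfl)
    rw [sub_self]; unfold FermiRG.torusDist; simpa using hΦ₀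

/-! ## §2 The narrow-bundle count with a prescribed set -/


open Classical in
/-- **The narrow-bundle count with a PRESCRIBED set of legs** (`|E| + 5 ≤ L`): strings agreeing with `τ` on `E`, free legs pairwise within pair angle `Φ₀`,
momenta summing to `R`: at most `2L⁴ · T_bound · N · K₀^{L − |E| − 4}` — the `(L − |E| − 2)` law for narrow bundles. [cite: BenfattoGiulianiMastropietro2003, §7.4 (s1.21)–(s1.25a) p.28 (L19–52)] -/
theorem card_narrowStrings_prescribed_le {ε : (Fin 2 → ℝ) → ℝ} {μ e₀ : ℝ} {u : ℝ → ℝ → ℝ} (hD : DispersionHyp ε μ e₀ u) {c₃ : ℝ} (hc₃ : 0 < c₃)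
    (h73 : ∀ (n ω : ℕ), ω < sectorCount n → ∀ p ∈ sSector u e₀ n ω,
      ∃ k₁ k₂ : ℝ,
        p = fermiPoint u (sectorCenter n ω) + k₁ • unitNormal u (sectorCenter n ω) 0 +
              k₂ • unitTangent u (sectorCenter n ω) 0 ∧
        |k₁| ≤ c₃ * (4 : ℝ) ^ (-(n : ℤ)) ∧ |k₂| ≤ c₃ * (2 : ℝ) ^ (-(n : ℤ)) ∧
        |fderiv ℝ ε p (unitTangent u (sectorCenter n ω) 0)| ≤ c₃ * (2 : ℝ) ^ (-(n : ℤ)))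
    {s₁ Φ cf Af Bf M₁ : ℝ} (hs₁ : 0 < s₁) (hM₁ : 0 ≤ M₁) (hΦ : 0 < Φ) (hcf : 0 < cf) (hcfA : cf ≤ Af) (hBf : 0 ≤ Bf)
    (hchart : ∀ θs : ℝ, ∃ f f' f'' : ℝ → ℝ, Measurable f ∧
        (∀ φ ∈ Icc (-Φ) Φ,
          f ((fermiPoint u (θs + φ) - fermiPoint u θs) ⬝ᵥ tdir θs) = -((fermiPoint u (θs + φ) - fermiPoint u θs) ⬝ᵥ dir θs)) ∧
        (∀ y ∈ Icc (-(s₁ / 4 * Φ)) (s₁ / 4 * Φ), HasDerivAt f (f' y) y ∧ HasDerivAt f' (f'' y) y ∧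
          cf ≤ f'' y ∧ f'' y ≤ Af ∧ |f' y| ≤ Bf) ∧
        (∀ φ ∈ Icc (-Φ) Φ, ∀ φ' ∈ Icc (-Φ) Φ,
          s₁ / 2 * |φ - φ'| ≤ |(fermiPoint u (θs + φ) - fermiPoint u θs) ⬝ᵥ tdir θs - (fermiPoint u (θs + φ') - fermiPoint u θs) ⬝ᵥ tdir θs| ∧
          |(fermiPoint u (θs + φ) - fermiPoint u θs) ⬝ᵥ tdir θs - (fermiPoint u (θs + φ') - fermiPoint u θs) ⬝ᵥ tdir θs| ≤ M₁ * |φ - φ'|) ∧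
        (fermiPoint u (θs + 0) - fermiPoint u θs) ⬝ᵥ tdir θs = 0)
    {n' L : ℕ} (E : Finset (Fin L)) (hE : E.card + 5 ≤ L) (τ : Fin L → Fin (sectorCount n')) (R : Fin 2 → ℝ) {Φ₀ : ℝ} (hΦ₀ : 0 ≤ Φ₀) (h2Φ₀ : 2 * Φ₀ ≤ Φ)
    (hreg : 6 * (M₁ * (2 * Φ₀)) + 3 * (L * (4 * c₃ * (2 : ℝ) ^ (-(n' : ℤ)))) + 2 * (s₁ / 2 * sectorWidth n') ≤ s₁ / 4 * Φ) :
    ((((Finset.univ : Finset (Fin L → Fin (sectorCount n'))).filter fun ω =>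
        ((∀ e ∈ E, ω e = τ e) ∧ (∀ i j : Fin L, i ∉ E → j ∉ E → pairAngle (sectorCenter n' (ω i)) (sectorCenter n' (ω j)) ≤ Φ₀)) ∧
        ∃ k : Fin L → (Fin 2 → ℝ), (∀ i, k i ∈ sSector u e₀ n' (ω i : ℕ)) ∧ ∑ i, k i = R).card : ℝ)) ≤
      2 * (L : ℝ) ^ 4 *
      ((2 * (L * (4 * c₃ * (2 : ℝ) ^ (-(n' : ℤ)))) / (s₁ / 2 * sectorWidth n') + 1) *
        (960 * Af * (2 * (L * (4 * c₃ * (2 : ℝ) ^ (-(n' : ℤ))) + Bf * (L * (4 * c₃ * (2 : ℝ) ^ (-(n' : ℤ))))) +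
          (4 * Bf + 1) * (s₁ / 2 * sectorWidth n')) / cf ^ 2 / (s₁ / 2 * sectorWidth n') ^ 2) *
      ((sectorCount n' : ℝ) * (2 * (2 * Φ₀ / sectorWidth n' + 1)) ^ (L - (E.card + 4)))) := by
  set Nar := (Finset.univ : Finset (Fin L → Fin (sectorCount n'))).filter fun ω =>
        ((∀ e ∈ E, ω e = τ e) ∧ (∀ i j : Fin L, i ∉ E → j ∉ E → pairAngle (sectorCenter n' (ω i)) (sectorCenter n' (ω j)) ≤ Φ₀)) ∧
        ∃ k : Fin L → (Fin 2 → ℝ), (∀ i, k i ∈ sSector u e₀ n' (ω i : ℕ)) ∧ ∑ i, k i = R with hNar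
  set Bnd : ℝ := (2 * (L * (4 * c₃ * (2 : ℝ) ^ (-(n' : ℤ)))) / (s₁ / 2 * sectorWidth n') + 1) *
        (960 * Af * (2 * (L * (4 * c₃ * (2 : ℝ) ^ (-(n' : ℤ))) + Bf * (L * (4 * c₃ * (2 : ℝ) ^ (-(n' : ℤ))))) +
          (4 * Bf + 1) * (s₁ / 2 * sectorWidth n')) / cf ^ 2 / (s₁ / 2 * sectorWidth n') ^ 2) *
      ((sectorCount n' : ℝ) * (2 * (2 * Φ₀ / sectorWidth n' + 1)) ^ (L - (E.card + 4))) with hBnd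
  have hw := sectorWidth_pos n'
  have hAf : 0 < Af := hcf.trans_le hcfA
  have hBnd0 : 0 ≤ Bnd := by rw [hBnd]; positivity
  -- the classes, indexed by ordered quadruples `(((s, a), b), c)` and a shift
  set Cl : (((Fin L × Fin L) × Fin L) × Fin L) → ℝ → Finset (Fin L → Fin (sectorCount n')) := fun q σ =>
    (Finset.univ : Finset (Fin L → Fin (sectorCount n'))).filter fun ω =>
        ((∀ e ∈ E, ω e = τ e) ∧ (∀ i j : Fin L, i ∉ E → j ∉ E → pairAngle (sectorCenter n' (ω i)) (sectorCenter n' (ω j)) ≤ Φ₀)) ∧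
        (∀ x ∈ ({q.1.1.2, q.1.2, q.2} : Finset (Fin L)), FermiRG.torusDist (sectorCenter n' (ω x) - (sectorCenter n' (ω q.1.1.1) + σ)) ≤ 2 * Φ₀) ∧
        ∃ k : Fin L → (Fin 2 → ℝ), (∀ i, k i ∈ sSector u e₀ n' (ω i : ℕ)) ∧ ∑ i, k i = R with hCl
  set Quads := (Finset.univ : Finset (((Fin L × Fin L) × Fin L) × Fin L)).filter fun q =>
      q.1.1.1 ∉ E ∧ q.1.1.2 ∉ E ∧ q.1.2 ∉ E ∧ q.2 ∉ E ∧ q.1.1.1 ≠ q.1.1.2 ∧ q.1.1.1 ≠ q.1.2 ∧ q.1.1.1 ≠ q.2 ∧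
        q.1.1.2 ≠ q.1.2 ∧ q.1.1.2 ≠ q.2 ∧ q.1.2 ≠ q.2 with hQuads
  -- the bound for one class
  have hclass : ∀ q ∈ Quads, ∀ σ : ℝ, ((Cl q σ).card : ℝ) ≤ Bnd := by
    intro q hq σ
    rw [hQuads, Finset.mem_filter] at hq
    obtain ⟨-, hs, ha, hb, hc, hsa, hsb, hsc, hab, hac, hbc⟩ := hq
    have h := card_narrowClass_prescribed_le hD hc₃ h73 hs₁ hM₁ hΦ hcf hcfA hBf hchart E τ q.1.1.1 q.1.1.2 q.1.2 q.2
      hs ha hb hc hsa hsb hsc hab hac hbc R hΦ₀ h2Φ₀ σ hreg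
    rw [hCl, hBnd]
    exact h
  -- coverage
  have hcover : Nar ⊆ Quads.biUnion fun q => Cl q 0 ∪ Cl q π := by
    intro ω hω
    rw [hNar, Finset.mem_filter] at hω
    obtain ⟨-, ⟨hωE, hnar⟩, hk⟩ := hω
    have hFcard : 5 ≤ (Finset.univ \ E).card := by
      rw [Finset.card_univ_sdiff, Fintype.card_fin]; omega
    obtain ⟨s, a, b, c, hs, ha, hb, hc, hsa, hsb, hsc, hab, hac, hbc, σ, hσ, hx⟩ :=
      exists_base_triple_of_free (Finset.univ \ E) hFcard (fun i => sectorCenter n' (ω i)) hΦ₀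
        (fun i j hi hj => hnar i j (Finset.mem_sdiff.1 hi).2 (Finset.mem_sdiff.1 hj).2)
    have hs' : s ∉ E := (Finset.mem_sdiff.1 hs).2
    have ha' : a ∉ E := (Finset.mem_sdiff.1 ha).2
    have hb' : b ∉ E := (Finset.mem_sdiff.1 hb).2
    have hc' : c ∉ E := (Finset.mem_sdiff.1 hc).2
    rw [Finset.mem_biUnion]
    refine ⟨(((s, a), b), c), ?_, ?_⟩
    · rw [hQuads, Finset.mem_filter]
      exact ⟨Finset.mem_univ _, hs', ha', hb', hc', hsa, hsb, hsc, hab, hac, hbc⟩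
    · rw [Finset.mem_union]
      rcases hσ with rfl | rfl
      · left; rw [hCl, Finset.mem_filter]; exact ⟨Finset.mem_univ _, ⟨hωE, hnar⟩, hx, hk⟩
      · right; rw [hCl, Finset.mem_filter]; exact ⟨Finset.mem_univ _, ⟨hωE, hnar⟩, hx, hk⟩
  -- summation
  have hQcard : (Quads.card : ℝ) ≤ (L : ℝ) ^ 4 := by
    have h1 : Quads.card ≤ (Finset.univ : Finset (((Fin L × Fin L) × Fin L) × Fin L)).card := Finset.card_le_card (Finset.filter_subset _ _)
    rw [Finset.card_univ, Fintype.card_prod, Fintype.card_prod, Fintype.card_prod, Fintype.card_fin] at h1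
    have h2 : (Quads.card : ℝ) ≤ ((L * L * L * L : ℕ) : ℝ) := by exact_mod_cast h1
    refine h2.trans_eq ?_
    push_cast; ring
  calc (Nar.card : ℝ) ≤ ((Quads.biUnion fun q => Cl q 0 ∪ Cl q π).card : ℝ) := by exact_mod_cast Finset.card_le_card hcover
    _ ≤ ∑ q ∈ Quads, ((Cl q 0 ∪ Cl q π).card : ℝ) := by exact_mod_cast Finset.card_biUnion_le
    _ ≤ ∑ q ∈ Quads, (Bnd + Bnd) := by
        refine Finset.sum_le_sum fun q hq => ?_
        calc ((Cl q 0 ∪ Cl q π).card : ℝ) ≤ ((Cl q 0).card : ℝ) + ((Cl q π).card : ℝ) := by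
              exact_mod_cast Finset.card_union_le _ _
          _ ≤ Bnd + Bnd := add_le_add (hclass q hq 0) (hclass q hq π)
    _ = Quads.card * (2 * Bnd) := by rw [Finset.sum_const, nsmul_eq_mul]; ring
    _ ≤ (L : ℝ) ^ 4 * (2 * Bnd) := mul_le_mul_of_nonneg_right hQcard (by positivity)
    _ = 2 * (L : ℝ) ^ 4 * Bnd := by ring

end Summit.HubbardSuperconductivity.HubbardSuperconductivity.Theorems.AbsUmklappCount

end
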